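import Mathlib.Tactic
import HarnessLib
import HarnessLib.Audit.Tags
import Summits.CriticalPhenomena.PercolationContinuityZ3.Theorems.PercNearOneGluingNoHeavyLowerTailSahiAntichainSplitSunflower

/-!
# Antichains, meets plus joins: a co-sunflower side is a good point

Support file (seat `prim-masterthm-p1`, gen 36; `--supports stmt-CriticalPhenomena-4575`).  No `sorry`, no new definitions, standard
axioms.  Memo `run/shared/lean/prim/prim-masterthm/FROM-prim-masterthm-p1-g36-DUALITY-PROJECTION-SUNFLOWER.md` §2.

SETTING (files `…SahiAntichainSplit*`): `above P r` / `below P r` are the members containing / avoiding `r`; the split step for V5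
needs `newLabels P r ≥ 2`.  The companion file `…SplitSunflower` proved it when `above P r` is a SUNFLOWER (all pairwise meets equal,
≥ 3 petals) and, by complement duality, when `below P r` is a CO-SUNFLOWER.

NEW HERE ([this work], gen 36) — the two remaining shapes.  **The co-sunflower step** `two_le_newLabels_of_above_cosunflower`: if the
members containing `r` have all pairwise UNIONS equal to one set `U` (at least three of them) and some member avoids `r`, then
`newLabels P r ≥ 2`.  [Proof: `joins (above) = {U}`, so a cross join `a ∪ b` is new iff it differs from `U`, iff `b ⊄ U` or `b`
misses a point of the co-petal `U \ a`; two distinct new joins are forbidden, which forces every member avoiding `r` to contain all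
co-petals but at most one, and then a cross meet `a ∩ b = b \ (U \ a)` cannot be a meet of two members avoiding `r` (each of those
meets the co-petal `U \ a`, by the antichain property) — a new meet next to the new join, or two new meets.]  By duality
(`…SahiAntichainDual`) **the sunflower-below step** `two_le_newLabels_of_below_sunflower`: the members avoiding `r` form a sunflower
with ≥ 3 petals ⟹ `newLabels P r ≥ 2`.  Together with `…SplitTwo/…SplitFive/…SplitSunflower`: at a bad point (`newLabels ≤ 1`)
NEITHER side is a pair, a sunflower or a co-sunflower — of the four V5-tight shapes only the `C([4],2)` blow-up remains possible as
a side (exhaustive data: both steps here in fact give `newLabels ≥ 3`).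
HONEST FRAMING: V5 itself remains OPEN. [this work]
-/

namespace Summit.CriticalPhenomena.PercolationContinuityZ3.Theorems.SahiColouredDaykin

open Finset

variable {α : Type*} [DecidableEq α]

/-- Two distinct new meets give `newLabels ≥ 2`. [this work] -/
theorem two_le_newLabels_of_two_newMeets {P : Finset (Finset α)} {r : α} {Z₁ Z₂ : Finset α}
    (h₁ : Z₁ ∈ newMeets P r) (h₂ : Z₂ ∈ newMeets P r) (hne : Z₁ ≠ Z₂) : 2 ≤ newLabels P r := by
  unfold newLabels
  have : 2 ≤ #(newMeets P r) := by
    have hsub : ({Z₁, Z₂} : Finset (Finset α)) ⊆ newMeets P r := by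
      intro Z hZ
      rcases mem_insert.1 hZ with rfl | hZ
      · exact h₁
      · rw [mem_singleton.1 hZ]; exact h₂
    have := card_le_card hsub
    rwa [card_pair hne] at this
  omega

section Cosunflower

variable {P : Finset (Finset α)} {r : α} {U : Finset α}

/-- In a co-sunflower side with ≥ 2 members every member lies inside `U`. [this work] -/
theorem subset_of_cosunflower (h2 : 1 < #(above P r)) (hU : ∀ a ∈ above P r, ∀ a' ∈ above P r, a ≠ a' → a ∪ a' = U)
    {a : Finset α} (ha : a ∈ above P r) : a ⊆ U := by
  obtain ⟨a', ha', hne⟩ := exists_mem_ne h2 a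
  rw [← hU a ha a' ha' hne.symm]
  exact subset_union_left

/-- Co-petals are disjoint: a point of `U` outside one member lies in every other member. [this work] -/
theorem mem_of_not_mem_of_cosunflower (hU : ∀ a ∈ above P r, ∀ a' ∈ above P r, a ≠ a' → a ∪ a' = U)
    {a a' : Finset α} (ha : a ∈ above P r) (ha' : a' ∈ above P r) (hne : a ≠ a') {z : α} (hzU : z ∈ U) (hza : z ∉ a) :
    z ∈ a' := by
  rw [← hU a ha a' ha' hne] at hzU
  rcases mem_union.1 hzU with h | h
  · exact absurd h hza
  · exact h

/-- Co-petals are nonempty: every member of an antichain co-sunflower side misses a point of `U`. [this work] -/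
theorem exists_mem_sdiff_of_cosunflower (hanti : IsAntichain (· ⊆ ·) (P : Set (Finset α))) (h2 : 1 < #(above P r))
    (hU : ∀ a ∈ above P r, ∀ a' ∈ above P r, a ≠ a' → a ∪ a' = U) {a : Finset α} (ha : a ∈ above P r) :
    ∃ z ∈ U, z ∉ a := by
  obtain ⟨a', ha', hne⟩ := exists_mem_ne h2 a
  have hnot : ¬ a' ⊆ a := hanti (mem_coe.2 (above_subset P r ha')) (mem_coe.2 (above_subset P r ha)) hne
  obtain ⟨z, hza', hza⟩ := not_subset.1 hnot
  exact ⟨z, subset_of_cosunflower h2 hU ha' hza', hza⟩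

/-- A member avoiding `r` is not inside a member containing `r` (antichain): it has a point outside it. [this work] -/
theorem exists_mem_not_mem_of_below (hanti : IsAntichain (· ⊆ ·) (P : Set (Finset α))) {a g : Finset α}
    (ha : a ∈ above P r) (hg : g ∈ below P r) : ∃ z ∈ g, z ∉ a := by
  obtain ⟨haP, hra⟩ := mem_above_iff.1 ha
  obtain ⟨hgP, hrg⟩ := mem_below_iff.1 hg
  have hne : g ≠ a := by rintro rfl; exact hrg hra
  exact not_subset.1 (hanti (mem_coe.2 hgP) (mem_coe.2 haP) hne)

/-- The joins of a co-sunflower side are `{U}`: a cross join `a ∪ b` is new iff it differs from `U`. [this work] -/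
theorem union_mem_newJoins_iff_ne (h2 : 1 < #(above P r)) (hU : ∀ a ∈ above P r, ∀ a' ∈ above P r, a ≠ a' → a ∪ a' = U)
    {a b : Finset α} (ha : a ∈ above P r) (hb : b ∈ below P r) : a ∪ b ∈ newJoins P r ↔ a ∪ b ≠ U := by
  rw [union_mem_newJoins_iff ha hb]
  constructor
  · intro h heq
    apply h
    obtain ⟨a', ha', hne⟩ := exists_mem_ne h2 a
    exact mem_joins_iff.2 ⟨a, ha, a', ha', hne.symm, by rw [heq, hU a ha a' ha' hne.symm]⟩
  · intro h hold
    obtain ⟨e, he, e', he', hee', heq⟩ := mem_joins_iff.1 hold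
    exact h (heq.trans (hU e he e' he' hee'))

/-- **The co-sunflower step.**  If the members containing `r` have all pairwise unions equal (at least three of them) and some member
avoids `r`, the split at `r` creates at least two new labels. [this work] -/
theorem two_le_newLabels_of_above_cosunflower (hanti : IsAntichain (· ⊆ ·) (P : Set (Finset α)))
    (h3 : 3 ≤ #(above P r)) (hB : (below P r).Nonempty)
    (hU : ∀ a ∈ above P r, ∀ a' ∈ above P r, a ≠ a' → a ∪ a' = U) : 2 ≤ newLabels P r := by
  have h2 : 1 < #(above P r) := by omega
  by_contra hlt
  -- two distinct new joins are forbidden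
  have noTwo : ∀ {a a' b b' : Finset α}, a ∈ above P r → a' ∈ above P r → b ∈ below P r → b' ∈ below P r →
      a ∪ b ≠ U → a' ∪ b' ≠ U → a ∪ b = a' ∪ b' := by
    intro a a' b b' ha ha' hb hb' hne hne'
    by_contra hdiff
    exact hlt (two_le_newLabels_of_two_newJoins ((union_mem_newJoins_iff_ne h2 hU ha hb).2 hne)
      ((union_mem_newJoins_iff_ne h2 hU ha' hb').2 hne') hdiff)
  by_cases hout : ∃ b ∈ below P r, ¬ b ⊆ U
  · /- Case A: a member avoiding `r` sticks out of `U`: all its cross joins are new, hence equal; then every member avoiding `r`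
       swallows every co-petal, and a cross meet is new. -/
    obtain ⟨b, hb, hbU⟩ := hout
    have hnewb : ∀ a ∈ above P r, a ∪ b ≠ U := by
      intro a _ heq
      exact hbU (heq ▸ subset_union_right)
    -- every member avoiding r contains every co-petal point
    have swallow : ∀ g ∈ below P r, ∀ a ∈ above P r, ∀ z ∈ U, z ∉ a → z ∈ g := by
      intro g hg a ha z hzU hza
      obtain ⟨a', ha', hne⟩ := exists_mem_ne h2 a
      have hza' : z ∈ a' := mem_of_not_mem_of_cosunflower hU ha ha' hne.symm hzU hza
      by_cases hgU : g ⊆ U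
      · -- `a ∪ g ⊆ U`; if it were `≠ U` it would be a second new join
        by_contra hzg
        have hne' : a ∪ g ≠ U := by
          intro heq
          have : z ∈ a ∪ g := by rw [heq]; exact hzU
          rcases mem_union.1 this with h | h
          · exact hza h
          · exact hzg h
        have heq := noTwo ha ha hg hb hne' (hnewb a ha)
        -- but `a ∪ g ⊆ U` while `a ∪ b ⊄ U`
        apply hbU
        intro w hw
        have : w ∈ a ∪ g := by rw [heq]; exact mem_union_right _ hw
        rcases mem_union.1 this with h | h
        · exact subset_of_cosunflower h2 hU ha h
        · exact hgU h
      · -- `g ⊄ U`: all cross joins over `g` are new, hence `a ∪ g = a' ∪ g`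
        have hng : ∀ e ∈ above P r, e ∪ g ≠ U := by
          intro e _ heq
          exact hgU (heq ▸ subset_union_right)
        have heq := noTwo ha ha' hg hg (hng a ha) (hng a' ha')
        have : z ∈ a ∪ g := by rw [heq]; exact mem_union_left _ hza'
        rcases mem_union.1 this with h | h
        · exact absurd h hza
        · exact h
    -- the new meet `a₂ ∩ b`
    obtain ⟨a₁, a₂, ha₁, ha₂, hne12⟩ := one_lt_card_iff.1 h2
    have hZ : a₂ ∩ b ∈ newMeets P r := by
      rw [inter_mem_newMeets_iff ha₂ hb]
      intro hold
      obtain ⟨g, hg, g', hg', _, heq⟩ := mem_meets_iff.1 hold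
      obtain ⟨z, hzU, hza₂⟩ := exists_mem_sdiff_of_cosunflower hanti h2 hU ha₂
      have hz : z ∈ a₂ ∩ b := by
        rw [heq]; exact mem_inter.2 ⟨swallow g hg a₂ ha₂ z hzU hza₂, swallow g' hg' a₂ ha₂ z hzU hza₂⟩
      exact hza₂ (mem_inter.1 hz).1
    exact hlt (two_le_newLabels_of_newMeet_newJoin hZ ((union_mem_newJoins_iff_ne h2 hU ha₂ hb).2 (hnewb a₂ ha₂)))
  · /- Case B: every member avoiding `r` lies inside `U`.  Then `a ∪ b = U` iff `b` contains the co-petal `U \ a`. -/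
    push Not at hout
    -- a member `g ⊆ U` deficient in the co-petal of `a` determines `a ∪ g ≠ U`
    have hnewiff : ∀ {a g : Finset α}, a ∈ above P r → g ∈ below P r → ∀ {z : α}, z ∈ U → z ∉ a → z ∉ g → a ∪ g ≠ U := by
      intro a g ha hg z hzU hza hzg heq
      have : z ∈ a ∪ g := by rw [heq]; exact hzU
      rcases mem_union.1 this with h | h
      · exact hza h
      · exact hzg h
    by_cases hfull : ∃ b₀ ∈ below P r, ∀ a ∈ above P r, ∀ z ∈ U, z ∉ a → z ∈ b₀
    · -- Case B-i: a full member: two new meets `a₁ ∩ b₀ ≠ a₂ ∩ b₀`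
      obtain ⟨b₀, hb₀, hfull₀⟩ := hfull
      obtain ⟨a₁, a₂, ha₁, ha₂, hne12⟩ := one_lt_card_iff.1 h2
      have hnewM : ∀ {a : Finset α}, a ∈ above P r → a ∩ b₀ ∈ newMeets P r := by
        intro a ha
        rw [inter_mem_newMeets_iff ha hb₀]
        intro hold
        obtain ⟨g, hg, g', hg', hgg', heq⟩ := mem_meets_iff.1 hold
        -- both `g` and `g'` meet the co-petal of `a`, at points outside `g ∩ g' ⊆ a`
        obtain ⟨z, hzg, hza⟩ := exists_mem_not_mem_of_below hanti ha hg
        obtain ⟨z', hz'g', hz'a⟩ := exists_mem_not_mem_of_below hanti ha hg'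
        have hzU : z ∈ U := hout g hg hzg
        have hz'U : z' ∈ U := hout g' hg' hz'g'
        have hzg' : z ∉ g' := by
          intro h
          have : z ∈ a ∩ b₀ := by rw [heq]; exact mem_inter.2 ⟨hzg, h⟩
          exact hza (mem_inter.1 this).1
        have hz'g : z' ∉ g := by
          intro h
          have : z' ∈ a ∩ b₀ := by rw [heq]; exact mem_inter.2 ⟨h, hz'g'⟩
          exact hz'a (mem_inter.1 this).1
        -- the two new joins `a ∪ g`, `a ∪ g'` must coincide
        have heq2 := noTwo ha ha hg hg' (hnewiff ha hg hz'U hz'a hz'g) (hnewiff ha hg' hzU hza hzg')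
        have : z ∈ a ∪ g' := by rw [← heq2]; exact mem_union_right _ hzg
        rcases mem_union.1 this with h | h
        · exact hza h
        · exact hzg' h
      have hdist : a₁ ∩ b₀ ≠ a₂ ∩ b₀ := by
        obtain ⟨z, hzU, hza₁⟩ := exists_mem_sdiff_of_cosunflower hanti h2 hU ha₁
        have hza₂ : z ∈ a₂ := mem_of_not_mem_of_cosunflower hU ha₁ ha₂ hne12 hzU hza₁
        have hzb₀ : z ∈ b₀ := hfull₀ a₁ ha₁ z hzU hza₁
        intro h
        have : z ∈ a₁ ∩ b₀ := by rw [h]; exact mem_inter.2 ⟨hza₂, hzb₀⟩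
        exact hza₁ (mem_inter.1 this).1
      exact hlt (two_le_newLabels_of_two_newMeets (hnewM ha₁) (hnewM ha₂) hdist)
    · -- Case B-ii: every member avoiding `r` is deficient in some co-petal — in fact in the same one
      push Not at hfull
      obtain ⟨b₀, hb₀⟩ := hB
      obtain ⟨a₀, ha₀, z₀, hz₀U, hz₀a₀, hz₀b₀⟩ := hfull b₀ hb₀
      have hW₀ : a₀ ∪ b₀ ≠ U := hnewiff ha₀ hb₀ hz₀U hz₀a₀ hz₀b₀
      -- any deficiency is a deficiency in the co-petal of `a₀`
      have honly : ∀ {a g : Finset α}, a ∈ above P r → g ∈ below P r → ∀ {z : α}, z ∈ U → z ∉ a → z ∉ g → a = a₀ := by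
        intro a g ha hg z hzU hza hzg
        by_contra hne
        have heq := noTwo ha ha₀ hg hb₀ (hnewiff ha hg hzU hza hzg) hW₀
        have hza₀ : z ∈ a₀ := mem_of_not_mem_of_cosunflower hU ha ha₀ hne hzU hza
        have : z ∈ a ∪ g := by rw [heq]; exact mem_union_left _ hza₀
        rcases mem_union.1 this with h | h
        · exact hza h
        · exact hzg h
      -- two members other than `a₀` give two distinct new meets with `b₀`
      obtain ⟨a', ha', ha'0, _⟩ := exists_third h3 a₀ a₀
      obtain ⟨a'', ha'', ha''0, ha''a'⟩ := exists_third h3 a₀ a'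
      have hnewM : ∀ {a : Finset α}, a ∈ above P r → a ≠ a₀ → a ∩ b₀ ∈ newMeets P r := by
        intro a ha hne
        rw [inter_mem_newMeets_iff ha hb₀]
        intro hold
        obtain ⟨g, hg, g', hg', _, heq⟩ := mem_meets_iff.1 hold
        obtain ⟨z, hzg, hza⟩ := exists_mem_not_mem_of_below hanti ha hg
        have hzU : z ∈ U := hout g hg hzg
        have hzg' : z ∉ g' := by
          intro h
          have : z ∈ a ∩ b₀ := by rw [heq]; exact mem_inter.2 ⟨hzg, h⟩
          exact hza (mem_inter.1 this).1
        exact hne (honly ha hg' hzU hza hzg')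
      have hdist : a' ∩ b₀ ≠ a'' ∩ b₀ := by
        obtain ⟨z, hzb₀, hza'⟩ := exists_mem_not_mem_of_below hanti ha' hb₀
        have hzU : z ∈ U := hout b₀ hb₀ hzb₀
        have hza'' : z ∈ a'' := mem_of_not_mem_of_cosunflower hU ha' ha'' ha''a'.symm hzU hza'
        intro h
        have : z ∈ a' ∩ b₀ := by rw [h]; exact mem_inter.2 ⟨hza'', hzb₀⟩
        exact hza' (mem_inter.1 this).1
      exact hlt (two_le_newLabels_of_two_newMeets (hnewM ha' ha'0) (hnewM ha'' ha''0) hdist)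

end Cosunflower

/-! ### The sunflower-below step, by duality -/

/-- **The sunflower-below step.**  If the members avoiding `r` form a sunflower with at least three petals (all pairwise meets equal)
and some member contains `r`, the split at `r` creates at least two new labels.  [Complement duality applied to the co-sunflower step.]
[this work] -/
theorem two_le_newLabels_of_below_sunflower {P : Finset (Finset α)} {r : α} {K : Finset α}
    (hanti : IsAntichain (· ⊆ ·) (P : Set (Finset α)))
    (h3 : 3 ≤ #(below P r)) (hA : (above P r).Nonempty)
    (hK : ∀ b ∈ below P r, ∀ b' ∈ below P r, b ≠ b' → b ∩ b' = K) : 2 ≤ newLabels P r := by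
  set F := insert r (P.sup id) with hF
  have hP : ∀ a ∈ P, a ⊆ F := subset_insert_sup P r
  have hr : r ∈ F := mem_insert_self _ _
  rw [← newLabels_image_compl hP hr]
  refine two_le_newLabels_of_above_cosunflower (U := F \ K) (isAntichain_image_compl hanti hP) ?_ ?_ ?_
  · rw [card_above_image_compl hP hr]; exact h3
  · rw [← card_pos, card_below_image_compl hP hr, card_pos]; exact hA
  · intro x hx y hy hxy
    rw [above_image_compl (P := P) hr] at hx hy
    obtain ⟨b, hb, rfl⟩ := mem_image.1 hx
    obtain ⟨b', hb', rfl⟩ := mem_image.1 hy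
    have hbb' : b ≠ b' := by rintro rfl; exact hxy rfl
    rw [← sdiff_inter_distrib_right, hK b hb b' hb' hbb']

/-- **No (co)sunflower side at a bad point.**  Summary of the four shape exclusions: if `newLabels P r ≤ 1` with both sides
nonempty, then neither side is a sunflower or a co-sunflower with at least three members. [this work] -/
theorem not_sunflower_sides_of_newLabels_le_one {P : Finset (Finset α)} {r : α}
    (hanti : IsAntichain (· ⊆ ·) (P : Set (Finset α))) (hA : (above P r).Nonempty) (hB : (below P r).Nonempty)
    (hbad : newLabels P r ≤ 1) :
    (3 ≤ #(above P r) → ∀ K, ¬ ∀ a ∈ above P r, ∀ a' ∈ above P r, a ≠ a' → a ∩ a' = K) ∧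
    (3 ≤ #(above P r) → ∀ U, ¬ ∀ a ∈ above P r, ∀ a' ∈ above P r, a ≠ a' → a ∪ a' = U) ∧
    (3 ≤ #(below P r) → ∀ K, ¬ ∀ b ∈ below P r, ∀ b' ∈ below P r, b ≠ b' → b ∩ b' = K) ∧
    (3 ≤ #(below P r) → ∀ U, ¬ ∀ b ∈ below P r, ∀ b' ∈ below P r, b ≠ b' → b ∪ b' = U) := by
  refine ⟨fun h3 K hK => ?_, fun h3 U hU => ?_, fun h3 K hK => ?_, fun h3 U hU => ?_⟩
  · have := two_le_newLabels_of_above_sunflower hanti h3 hB hK; omega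
  · have := two_le_newLabels_of_above_cosunflower hanti h3 hB hU; omega
  · have := two_le_newLabels_of_below_sunflower hanti h3 hA hK; omega
  · have := two_le_newLabels_of_below_cosunflower hanti h3 hA hU; omega

end Summit.CriticalPhenomena.PercolationContinuityZ3.Theorems.SahiColouredDaykin
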